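/-
Copyright (c) 2026 the pub-hodgecm-mathlib formalisation cell (harness21).  Prover seat hodgecm-mathlib-LH4-p08 (g10), req620 Track A «(D-RAM) FOUR-FRAME» squad, helper lane
on h413 = stmt-HodgeConjecture-24833 (count-neutral).  β sub-dealer LH4-p05 (g8) LEDGER #12∕#13: ROW R6 «SPECIAL κ-CLASSES», tower 3 — the (β2-foot) brick, slot 2 and the
closed forms on LH4-p18 (g0)'s representatives.  2026-09-04.
-/
import Summits.HodgeConjecture.HodgeConjecture.Theorems.F0P3cDyRamLabelledOddKappaClassIndicatorsG3   -- ★ (this seat): slots 0∕1 at the foot; brings ★ p861738 `witness_mem_fixedUnitStabilizer_latt_G3`, ★ `mem_fixedUnitStabilizer_latt_G3_iff`, the ★ conductor lemmas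
import Summits.HodgeConjecture.HodgeConjecture.Theorems.F0P3cDyRamSqDatumDerivedFence          -- ★ `d_le_t_add_one` (`d ≤ v(2) + 1`)
import HarnessLib

/-!
# Crux `H413`, line LH4 «(D-RAM) FOUR-FRAME» — (β) Stage B, β-BOARD row R6 (tower 3), STEP (β2-foot) continued: the slot-2 INDICATOR at the κ-class foot, and the three
# indicators of the representative `M(g)` in CLOSED FORM — `𝟙₀(g) = 𝟙₁(g) = [2d − 1 ≤ ρ]`, `𝟙₂(g) = [2d ≤ ρ + 2t′ + 1]` (`t′ = k₃ − ρ − t`), independent of `g`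

Cell `hodgecm-mathlib` (D-0151), FLOOR 0, crux item H413 = `stmt-HodgeConjecture-24833`, route `HCCMUnconditional`; squad F0∕P3c∕LH4.  THEOREMS ONLY (no `def`, no instance, no
notation, no `sorry`, default heartbeats); ★-only imports; lane `--supports stmt-HodgeConjecture-24833 --as helper` (count-neutral); pays NO row, states NO law.

THE MATHEMATICS (sequel of `…KappaClassIndicatorsG3`, same letters: G₃ normal form `M₀`, `x z = −yϖ^{ρ+s}g⁻¹`, abstract correction `c` with `σc = c`, `|c|·|ϖ^s| = 1`).
* §1 `indicator_two_latt_G3_foot_iff` (`2d − 1 ≤ 2ρ`): `𝟙₂ ↔ |ϖ^{ρ+s}|·|c − g⁻¹| ≤ |ϖ^{2d−1}|`.  NEW PHENOMENON at the foot: `ω(u₂∕u₀)` and `ω(1 + (u₁∕u₀ − 1)c)` are not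
  separately `1` below the conductor; the mixed congruence of ★ `mem_fixedUnitStabilizer_latt_G3_iff` with the representative relation reads `u₂∕u₀ ≡ 1 − a∕g (mod ϖ^{2ρ})`,
  `a = u₁∕u₀ − 1`, so the tested quantity is the PRODUCT `(1 − a∕g)(1 + ac) = 1 + a(c − g⁻¹) − a²c∕g` (`|a| ≤ |ϖ^{ρ+s}|`, `|a²c∕g| ≤ |ϖ|^{2ρ} ≤ |ϖ|^{2d−1}`): a norm for all
  such `a` iff `|ϖ^{ρ+s}(c − g⁻¹)| ≤ |ϖ|^{2d−1}`, else the killer `a = (c′−1)∕(c − g⁻¹)` gives `(1 − a∕g)(1 + ac) = c′·(1 − a²c∕(gc′))`.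
* §2 `correction_latt_G3_rep_foot_eq`, `v_correction_latt_G3_rep_foot`: on LH4-p18 (g0)'s κ-class representatives (`x = y = (1+g)⁻¹`, `z = −ϖ^{ρ+2t}g⁻¹`, polarisation
  `P·(−(1+g)⁻¹, 1, g)`, tokens `e_B` at `ρ`, `e_C` at `k₃ > ρ + t`) the coefficient of ★ p862059 §3 is `c(g) = ((1+g)κ′ − g)⁻¹`, `κ′ = e_Cπ₀^{k₃}∕(e_Bπ₀^{ρ})`: σ-fixed,
  `|c|·|ϖ^{2t}| = 1`, and `c − g⁻¹ = (2g − (1+g)κ′)∕(((1+g)κ′ − g)g)` with `|2g| = |ϖ|^{v(2)+2t}`, `|(1+g)κ′| = |ϖ|^{2t+2t′}`; since `ρ + v(2) ≥ 2d − 1` for `d ≤ ρ`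
  (★ `d_le_t_add_one`), the slot-2 test is `↔ 2d ≤ ρ + 2t′ + 1` (a possible cancellation on the tie `v(2) = 2t′` only helps, and there the test already passes).
* §3 `indicators_latt_G3_rep_foot`: the three closed forms at once, in the letters of ★ p862059 §3's `ind`.
HONEST LABEL.  Count-neutral; the κ-row, hRest, (β-BAL), (β), T₊ remain OPEN; `HC_CM` is proved only modulo the 7 printed citations (2 remaining named inputs: hLiu418 =
`stmt-HodgeConjecture-24832`, h413 = `stmt-HodgeConjecture-24833`) until rung 0 closes.

## References
* [Serre1979] J.-P. Serre, *Local Fields*, GTM 67 (1979), Ch. III §3 Prop. 7; Ch. V §3 Prop. 5, Cor. 2–3; Ch. XV §2.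
* [Kottwitz1986BaseChangeUnits] R. E. Kottwitz, *Base change for unit elements of Hecke algebras*, Compositio Math. 60 (1986), §1 pp. 240–241 (torus stabilisers).
* [LanglandsShelstad1987] R. P. Langlands, D. Shelstad, *On the definition of transfer factors*, Math. Ann. 278 (1987), §3.
-/

set_option autoImplicit false

noncomputable section

namespace Summit.HodgeConjecture.HodgeConjecture.Cruxes.H413.F0P3cDyRamLabelledOddKappaClassIndicatorTwoG3

open Literature.NumberTheory.Automorphic Literature.NumberTheory.Automorphic.HermitianLattice
open Literature.NumberTheory.Automorphic.UnitaryLatticeTree Literature.NumberTheory.Automorphic.UnitaryThreeFourFrame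
open Literature.NumberTheory.LocalFields Literature.NumberTheory.LocalFields.WildQuadraticDatum
open Summit.HodgeConjecture.HodgeConjecture.Cruxes.H413.F0P3cDyRamFourFramePieces
open Summit.HodgeConjecture.HodgeConjecture.Cruxes.H413.F0P3cDyRamDiagonalTorusDefs
open Summit.HodgeConjecture.HodgeConjecture.Cruxes.H413.F0P3cDyRamDiagonalStrataDefs
open Summit.HodgeConjecture.HodgeConjecture.Cruxes.H413.F0P3cDyRamDiagonalGluedStratumG3
open Summit.HodgeConjecture.HodgeConjecture.Cruxes.H413.F0P3cDyRamLabelledOddBoundaryIndicatorsG3 (witness_mem_fixedUnitStabilizer_latt_G3)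
open Summit.HodgeConjecture.HodgeConjecture.Cruxes.H413.F0P3cDyRamLabelledOddKappaClassIndicatorsG3 (indicator_zero_latt_G3_foot_iff indicator_one_latt_G3_foot_iff)
open Summit.HodgeConjecture.HodgeConjecture.Cruxes.H413.F0P3cDyRamDiagonalKappaSplitCountEval (normSign_mul_self)
open Summit.HodgeConjecture.HodgeConjecture.Cruxes.H413.F0P3cDyRamSqDatumDerivedFence (d_le_t_add_one)
open scoped Valued WithZero Matrix MatrixGroups

variable {K : Type} [Field K] [Valued K ℤᵐ⁰] [CompleteSpace K] [Fintype 𝓀[K]] {σ : K →+* K} {ϖ : K} {d t : ℕ}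

/-! ## §1  The slot-2 indicator at the foot: the product `ω(u₂∕u₀)·ω(1 + (u₁∕u₀ − 1)c)` is tested on `(1 − a∕g)(1 + ac) = 1 + a(c − g⁻¹) − a²c∕g` -/

/-- **THE SLOT-2 INDICATOR AT THE FOOT.**  Same letters (`|y| = 1` too) and `2d − 1 ≤ 2ρ`:
`(∀ u ∈ S_F(M₀), ω(u₂)·(ω(u₀)·ω(1 + (u₁∕u₀ − 1)·c)) = 1) ↔ |ϖ^{ρ+s}|·|c − g⁻¹| ≤ |ϖ^{2d−1}|`.  On `S_F(M₀)` the representative relation `x z = −yϖ^{ρ+s}g⁻¹` turns the mixed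
congruence of ★ `mem_fixedUnitStabilizer_latt_G3_iff` into `u₂∕u₀ ≡ 1 − a∕g (mod ϖ^{2ρ})`, `a = u₁∕u₀ − 1`, so the tested quantity is `(1 − a∕g)(1 + ac) = 1 + a(c − g⁻¹) − a²c∕g`
with `|a| ≤ |ϖ^{ρ+s}|`, `|a²c∕g| ≤ |ϖ|^{2ρ}`: a norm for every such `a` iff `|ϖ^{ρ+s}(c − g⁻¹)| ≤ |ϖ|^{2d−1}` (else the killer `a = (c′−1)∕(c − g⁻¹)`, `(1 − a∕g)(1+ac) = c′(1 − a²c∕(gc′))`).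
[cite: Serre1979, Ch. V §3 Cor. 3; Ch. XV §2] [cite: Kottwitz1986BaseChangeUnits, §1 pp. 240–241] -/
theorem indicator_two_latt_G3_foot_iff (hD : IsRamifiedQuadraticDatum σ ϖ d t) (h2 : Valued.v (2 : K) < 1)
    {ρ s : ℕ} (hρ : 1 ≤ ρ) (hs : 1 ≤ s) (hρd : 2 * d - 1 ≤ 2 * ρ) {x y z g : K} (hx : Valued.v x = 1) (hy : Valued.v y = 1) (hz : Valued.v z = Valued.v (ϖ ^ ρ))
    (hσg : σ g = g) (hg : Valued.v g = Valued.v (ϖ ^ s)) (hxyz : x * z = -(y * ϖ ^ (ρ + s) * g⁻¹))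
    {M₀ : Submodule 𝒪[K] (Fin 3 → K)} (hM₀ : M₀ = latt (!![1, 0, 0; x, ϖ ^ (ρ + s), 0; y, z, ϖ ^ (2 * ρ)] : Matrix (Fin 3) (Fin 3) K))
    {c : K} (hσc : σ c = c) (hcv : Valued.v c * Valued.v (ϖ ^ s) = 1) :
    (∀ u ∈ fixedUnitStabilizer σ M₀,
        normSign σ ((u 2 : Kˣ) : K) * (normSign σ ((u 0 : Kˣ) : K) * normSign σ (1 + (((u 1 : Kˣ) : K) / ((u 0 : Kˣ) : K) - 1) * c)) = 1) ↔
      Valued.v (ϖ ^ (ρ + s)) * Valued.v (c - g⁻¹) ≤ Valued.v (ϖ ^ (2 * d - 1)) := by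
  obtain ⟨hσ, -, hϖ, hfix, -, hd1, -⟩ := id hD
  haveI : Finite 𝓀[K] := Finite.of_fintype _
  have hϖ0 : ϖ ≠ 0 := fun h0 => by rw [h0, map_zero] at hϖ; exact WithZero.coe_ne_zero hϖ.symm
  have hϖ1 : Valued.v ϖ ≤ 1 := by rw [hϖ, ← WithZero.exp_zero, WithZero.exp_le_exp]; norm_num
  have hϖlt : Valued.v ϖ < 1 := by rw [hϖ, ← WithZero.exp_zero, WithZero.exp_lt_exp]; norm_num
  have hq : ∀ n : ℕ, Valued.v (ϖ ^ n) = WithZero.exp (-(n : ℤ)) := fun n => by rw [map_pow, v_varpi_pow hϖ]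
  have hcv' : Valued.v c = WithZero.exp ((s : ℕ) : ℤ) := by
    rw [hq] at hcv
    calc Valued.v c = Valued.v c * WithZero.exp (-((s : ℕ) : ℤ)) * WithZero.exp ((s : ℕ) : ℤ) := by
          rw [mul_assoc, ← WithZero.exp_add, neg_add_cancel, WithZero.exp_zero, mul_one]
      _ = WithZero.exp ((s : ℕ) : ℤ) := by rw [hcv, one_mul]
  have hc0 : c ≠ 0 := fun h => by rw [h, map_zero] at hcv'; exact WithZero.coe_ne_zero hcv'.symm
  have hg0 : g ≠ 0 := fun h => by
    rw [h, map_zero] at hg; exact (Valuation.ne_zero_iff Valued.v |>.2 (pow_ne_zero s hϖ0)) hg.symm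
  have hginv : Valued.v g⁻¹ = WithZero.exp ((s : ℕ) : ℤ) := by rw [map_inv₀, hg, hq, ← WithZero.exp_neg, neg_neg]
  -- the tube and the correction on the stabiliser
  have htube : ∀ u ∈ fixedUnitStabilizer σ M₀, Valued.v (((u 1 : Kˣ) : K) / ((u 0 : Kˣ) : K) - 1) ≤ Valued.v (ϖ ^ (ρ + s)) := by
    intro u hu
    have hu' := hu
    rw [hM₀] at hu'
    have h10 := (v_sub_le_of_mem_fixedUnitStabilizer_latt_G3 σ hϖ0 hϖ1 hx hz hu').1
    obtain ⟨huv, -⟩ := (mem_fixedUnitTorus_iff σ u).1 (Subgroup.mem_inf.1 (show u ∈ fixedUnitStabilizer σ M₀ from hu)).2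
    rw [show ((u 1 : Kˣ) : K) / ((u 0 : Kˣ) : K) - 1 = (((u 1 : Kˣ) : K) - (u 0 : Kˣ)) / ((u 0 : Kˣ) : K) by field_simp, map_div₀, huv 0, div_one]
    exact h10
  -- `|a²c∕g| ≤ |ϖ|^{2ρ} ≤ |ϖ|^{2d−1}` for `|a| ≤ |ϖ^{ρ+s}|`
  have hsq : ∀ a : K, Valued.v a ≤ Valued.v (ϖ ^ (ρ + s)) → Valued.v (a ^ 2 * c / g) ≤ Valued.v ϖ ^ (2 * d - 1) := by
    intro a ha
    rw [div_eq_mul_inv, map_mul, map_mul, map_pow, hginv, hcv', v_varpi_pow hϖ]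
    calc Valued.v a ^ 2 * WithZero.exp ((s : ℕ) : ℤ) * WithZero.exp ((s : ℕ) : ℤ)
        ≤ Valued.v (ϖ ^ (ρ + s)) ^ 2 * WithZero.exp ((s : ℕ) : ℤ) * WithZero.exp ((s : ℕ) : ℤ) :=
          mul_le_mul' (mul_le_mul' (pow_le_pow_left' ha 2) le_rfl) le_rfl
      _ ≤ WithZero.exp (-((2 * d - 1 : ℕ) : ℤ)) := by
        rw [hq, ← WithZero.exp_nsmul, nsmul_eq_mul, ← WithZero.exp_add, ← WithZero.exp_add, WithZero.exp_le_exp]; push_cast; omega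
  constructor
  · -- (⇒): if `|ϖ^{ρ+s}(c − g⁻¹)| > |ϖ|^{2d−1}` a killer exists
    intro hall
    by_contra hlt
    rw [not_le] at hlt
    have hcg0 : c - g⁻¹ ≠ 0 := fun h => by rw [h, map_zero, mul_zero] at hlt; exact not_lt_zero hlt
    obtain ⟨n, hn⟩ := hfix (c - g⁻¹) (by rw [map_sub, hσc, map_inv₀, hσg]) hcg0
    have hn' : -((2 * d - 1 : ℕ) : ℤ) < -((ρ + s : ℕ) : ℤ) + 2 * n := by
      rw [hq, hq, hn, ← WithZero.exp_add, WithZero.exp_lt_exp] at hlt; exact hlt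
    obtain ⟨c', hσc', hc'1, hc'v, hc'n⟩ := exists_fixed_unit_not_norm_v_sub_one_le hD h2
    have hc'0 : c' ≠ 0 := fun h => by rw [h, map_zero] at hc'1; exact zero_ne_one hc'1
    set a : K := (c' - 1) / (c - g⁻¹) with hadef
    have hσa : σ a = a := by rw [hadef, map_div₀, map_sub, hσc', map_one, map_sub, hσc, map_inv₀, hσg]
    have ha : Valued.v a ≤ Valued.v (ϖ ^ (ρ + s)) := by
      rw [hadef, map_div₀, hn, hq, div_eq_mul_inv, ← WithZero.exp_neg]
      calc Valued.v (c' - 1) * WithZero.exp (-(2 * n))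
          ≤ WithZero.exp (-(2 * ((d - 1 : ℕ) : ℤ))) * WithZero.exp (-(2 * n)) := by gcongr
        _ ≤ WithZero.exp (-((ρ + s : ℕ) : ℤ)) := by rw [← WithZero.exp_add, WithZero.exp_le_exp]; push_cast at hn' ⊢; omega
    have ha1 : Valued.v a < 1 := ha.trans_lt (by rw [map_pow]; exact pow_lt_one₀ zero_le hϖlt (by omega))
    have hag1 : Valued.v (a / g) < 1 := by
      rw [map_div₀, hg, div_lt_iff₀ ((Valuation.pos_iff _).2 (pow_ne_zero _ hϖ0))]
      refine ha.trans_lt ?_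
      rw [one_mul, hq, hq, WithZero.exp_lt_exp]; omega
    have h1 : (1 + a : K) ≠ 0 := fun h => by
      have := Valued.v.map_one_add_of_lt ha1; rw [h, map_zero] at this; exact zero_ne_one this
    have h2' : (1 - a / g : K) ≠ 0 := fun h => by
      have := Valued.v.map_one_add_of_lt (x := -(a / g)) (by rw [Valuation.map_neg]; exact hag1)
      rw [← sub_eq_add_neg, h, map_zero] at this; exact zero_ne_one this
    have hmem := witness_mem_fixedUnitStabilizer_latt_G3 hϖ hρ hx hz hσg hg hxyz hσa ha h1 h2'
    rw [← hM₀] at hmem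
    have hval := hall _ hmem
    have hu0 : (((![1, Units.mk0 (1 + a) h1, Units.mk0 (1 - a / g) h2'] : Fin 3 → Kˣ) 0 : Kˣ) : K) = 1 := rfl
    have hu1 : (((![1, Units.mk0 (1 + a) h1, Units.mk0 (1 - a / g) h2'] : Fin 3 → Kˣ) 1 : Kˣ) : K) = 1 + a := rfl
    have hu2 : (((![1, Units.mk0 (1 + a) h1, Units.mk0 (1 - a / g) h2'] : Fin 3 → Kˣ) 2 : Kˣ) : K) = 1 - a / g := rfl
    rw [hu0, hu1, hu2, div_one, add_sub_cancel_left, (show normSign σ (1 : K) = 1 from normSign_of_isNorm σ ⟨1, by rw [map_one, one_mul]⟩), one_mul] at hval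
    have hσ1a : σ (1 - a / g) = 1 - a / g := by rw [map_sub, map_one, map_div₀, hσa, hσg]
    have hσac : σ (1 + a * c) = 1 + a * c := by rw [map_add, map_one, map_mul, hσa, hσc]
    have hac1 : Valued.v (a * c) < 1 := by
      rw [map_mul]
      calc Valued.v a * Valued.v c ≤ Valued.v (ϖ ^ (ρ + s)) * Valued.v c := by gcongr
        _ < 1 := by rw [hq, hcv', ← WithZero.exp_add, ← WithZero.exp_zero, WithZero.exp_lt_exp]; push_cast; omega
    have hac0 : (1 + a * c : K) ≠ 0 := fun h => by
      have := Valued.v.map_one_add_of_lt hac1; rw [h, map_zero] at this; exact zero_ne_one this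
    rw [← normSign_mul_of_fixed hD hσ1a hσac h2' hac0] at hval
    set w : K := 1 - a ^ 2 * c / (g * c') with hwdef
    have hprod : (1 - a / g) * (1 + a * c) = c' * w := by
      have hkey : a * (c - g⁻¹) = c' - 1 := by rw [hadef, div_mul_cancel₀ _ hcg0]
      have e1 : (1 - a / g) * (1 + a * c) = 1 + a * (c - g⁻¹) - a ^ 2 * c / g := by rw [div_eq_mul_inv, div_eq_mul_inv]; ring
      have e2 : c' * w = c' - a ^ 2 * c / g := by
        rw [hwdef, mul_sub, mul_one, mul_div_assoc', mul_comm g c', mul_div_mul_left _ _ hc'0]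
      rw [e1, e2, hkey]; ring
    have hσw : σ w = w := by rw [hwdef, map_sub, map_one, map_div₀, map_mul, map_pow, hσa, hσc, map_mul, hσg, hσc']
    have hwv : Valued.v (w - 1) ≤ Valued.v ϖ ^ (2 * d - 1) := by
      rw [hwdef, sub_sub_cancel_left, Valuation.map_neg, show a ^ 2 * c / (g * c') = a ^ 2 * c / g / c' by rw [div_div], map_div₀, hc'1, div_one]
      exact hsq a ha
    rw [hprod, normSign_mul_eq_neg_of_not_norm hD hσc' hc'n hσw ?_] at hval
    · have hw1 : normSign σ w = 1 := normSign_eq_one_of_fixed_of_v_sub_one_le hD hσw (le_refl _) hwv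
      rw [hw1] at hval
      norm_num at hval
    · intro h
      rw [h, zero_sub, Valuation.map_neg, map_one] at hwv
      have : Valued.v ϖ ^ (2 * d - 1) < 1 := pow_lt_one₀ zero_le hϖlt (by omega)
      exact absurd (hwv.trans_lt this) (lt_irrefl _)
  · -- (⇐): the product `u₂u₀(1 + ac) = u₀²·W`, `|W − 1| ≤ |ϖ|^{2d−1}`
    intro hle u hu
    obtain ⟨huv, huσ⟩ := (mem_fixedUnitTorus_iff σ u).1 (Subgroup.mem_inf.1 (show u ∈ fixedUnitStabilizer σ M₀ from hu)).2
    have hu' := hu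
    rw [hM₀] at hu'
    obtain ⟨-, -, -, h4⟩ := (mem_fixedUnitStabilizer_latt_G3_iff σ hϖ0 hx y hz u).1 hu'
    have hA := htube u hu
    -- the mixed congruence: `ε = (u₂ − u₀) + (u₁ − u₀)g⁻¹` has `|ε| ≤ |ϖ^{2ρ}|`
    set ε : K := (((u 2 : Kˣ) : K) - (u 0 : Kˣ)) + (((u 1 : Kˣ) : K) - (u 0 : Kˣ)) * g⁻¹ with hεdef
    have hε : Valued.v ε ≤ Valued.v (ϖ ^ (2 * ρ)) := by
      have h : (((u 2 : Kˣ) : K) - (u 0 : Kˣ)) * y * ϖ ^ (ρ + s) + (((u 0 : Kˣ) : K) - (u 1 : Kˣ)) * x * z = ε * (y * ϖ ^ (ρ + s)) := by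
        rw [hεdef, mul_assoc (((u 0 : Kˣ) : K) - (u 1 : Kˣ)), hxyz]; ring
      rw [h, map_mul, map_mul, hy, one_mul, hq, hq] at h4
      rw [hq]
      calc Valued.v ε = Valued.v ε * WithZero.exp (-((ρ + s : ℕ) : ℤ)) * WithZero.exp ((ρ + s : ℕ) : ℤ) := by
            rw [mul_assoc, ← WithZero.exp_add, neg_add_cancel, WithZero.exp_zero, mul_one]
        _ ≤ WithZero.exp (-((3 * ρ + s : ℕ) : ℤ)) * WithZero.exp ((ρ + s : ℕ) : ℤ) := by gcongr
        _ = WithZero.exp (-((2 * ρ : ℕ) : ℤ)) := by rw [← WithZero.exp_add]; congr 1; push_cast; ring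
    have hσA : σ (((u 1 : Kˣ) : K) / ((u 0 : Kˣ) : K) - 1) = ((u 1 : Kˣ) : K) / ((u 0 : Kˣ) : K) - 1 := by rw [map_sub, map_div₀, huσ 1, huσ 0, map_one]
    have hσw : σ (1 + (((u 1 : Kˣ) : K) / ((u 0 : Kˣ) : K) - 1) * c) = 1 + (((u 1 : Kˣ) : K) / ((u 0 : Kˣ) : K) - 1) * c := by
      rw [map_add, map_one, map_mul, hσA, hσc]
    have hAc : Valued.v ((((u 1 : Kˣ) : K) / ((u 0 : Kˣ) : K) - 1) * c) ≤ 1 := by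
      rw [map_mul]
      calc Valued.v (((u 1 : Kˣ) : K) / ((u 0 : Kˣ) : K) - 1) * Valued.v c ≤ Valued.v (ϖ ^ (ρ + s)) * Valued.v c := by gcongr
        _ ≤ 1 := by rw [hq, hcv', ← WithZero.exp_add, ← WithZero.exp_zero, WithZero.exp_le_exp]; push_cast; omega
    have hAc1 : Valued.v (1 + (((u 1 : Kˣ) : K) / ((u 0 : Kˣ) : K) - 1) * c) ≤ 1 :=
      (Valuation.map_add _ _ _).trans (max_le (le_of_eq (map_one _)) hAc)
    have hw0 : (1 + (((u 1 : Kˣ) : K) / ((u 0 : Kˣ) : K) - 1) * c : K) ≠ 0 := fun h => by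
      have h1 : Valued.v (1 + (((u 1 : Kˣ) : K) / ((u 0 : Kˣ) : K) - 1) * c - (((u 1 : Kˣ) : K) / ((u 0 : Kˣ) : K) - 1) * c) ≤
          Valued.v ϖ ^ ρ := by
        rw [h, zero_sub, Valuation.map_neg, map_mul, ← map_pow]
        calc Valued.v (((u 1 : Kˣ) : K) / ((u 0 : Kˣ) : K) - 1) * Valued.v c ≤ Valued.v (ϖ ^ (ρ + s)) * Valued.v c := by gcongr
          _ = Valued.v (ϖ ^ ρ) := by rw [pow_add, map_mul, mul_assoc, mul_comm (Valued.v (ϖ ^ s)), hcv, mul_one]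
      rw [add_sub_cancel_right, map_one] at h1
      exact absurd (h1.trans_lt (pow_lt_one₀ zero_le hϖlt (by omega))) (lt_irrefl _)
    rw [← mul_assoc, ← normSign_mul_of_fixed hD (huσ 2) (huσ 0) (u 2).ne_zero (u 0).ne_zero,
      ← normSign_mul_of_fixed hD (by rw [map_mul, huσ 2, huσ 0]) hσw (mul_ne_zero (u 2).ne_zero (u 0).ne_zero) hw0]
    set W : K := ((u 2 : Kˣ) : K) / ((u 0 : Kˣ) : K) * (1 + (((u 1 : Kˣ) : K) / ((u 0 : Kˣ) : K) - 1) * c) with hWdef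
    have hσW : σ W = W := by rw [hWdef, map_mul, map_div₀, huσ 2, huσ 0, hσw]
    have hWv : Valued.v (W - 1) ≤ Valued.v ϖ ^ (2 * d - 1) := by
      have hW : W - 1 = (((u 1 : Kˣ) : K) / ((u 0 : Kˣ) : K) - 1) * (c - g⁻¹) + ε / ((u 0 : Kˣ) : K) * (1 + (((u 1 : Kˣ) : K) / ((u 0 : Kˣ) : K) - 1) * c) -
          (((u 1 : Kˣ) : K) / ((u 0 : Kˣ) : K) - 1) ^ 2 * c / g := by
        rw [hWdef, hεdef]; field_simp; ring
      rw [hW]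
      refine (Valuation.map_sub _ _ _).trans (max_le ((Valuation.map_add _ _ _).trans (max_le ?_ ?_)) ?_)
      · rw [map_mul, ← map_pow]
        calc Valued.v (((u 1 : Kˣ) : K) / ((u 0 : Kˣ) : K) - 1) * Valued.v (c - g⁻¹) ≤ Valued.v (ϖ ^ (ρ + s)) * Valued.v (c - g⁻¹) := by gcongr
          _ ≤ Valued.v (ϖ ^ (2 * d - 1)) := hle
      · rw [map_mul, map_div₀, huv 0, div_one, v_varpi_pow hϖ]
        calc Valued.v ε * Valued.v (1 + (((u 1 : Kˣ) : K) / ((u 0 : Kˣ) : K) - 1) * c) ≤ Valued.v (ϖ ^ (2 * ρ)) * 1 := mul_le_mul' hε hAc1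
          _ ≤ WithZero.exp (-((2 * d - 1 : ℕ) : ℤ)) := by rw [mul_one, hq, WithZero.exp_le_exp]; omega
      · have hA' : Valued.v ((((u 1 : Kˣ) : K) - (u 0 : Kˣ)) / ((u 0 : Kˣ) : K)) ≤ Valued.v (ϖ ^ (ρ + s)) := by
          rwa [show (((u 1 : Kˣ) : K) - (u 0 : Kˣ)) / ((u 0 : Kˣ) : K) = ((u 1 : Kˣ) : K) / ((u 0 : Kˣ) : K) - 1 by field_simp]
        rw [show (((u 1 : Kˣ) : K) - (u 0 : Kˣ)) / ((u 0 : Kˣ) : K) = ((u 1 : Kˣ) : K) / ((u 0 : Kˣ) : K) - 1 by field_simp] at hA'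
        exact hsq _ hA'
    rw [show ((u 2 : Kˣ) : K) * ((u 0 : Kˣ) : K) * (1 + (((u 1 : Kˣ) : K) / ((u 0 : Kˣ) : K) - 1) * c) = ((u 0 : Kˣ) : K) * ((u 0 : Kˣ) : K) * W by
        rw [hWdef]; field_simp,
      normSign_mul_eq_of_fixed_of_v_sub_one_le hD _ hσW (le_refl _) hWv]
    exact normSign_of_isNorm σ ⟨((u 0 : Kˣ) : K), by rw [huσ 0]⟩

/-! ## §2  The correction coefficient of the κ-class representative: `c(g) = ((1+g)κ′ − g)⁻¹`, `|c|·|ϖ^{2t}| = 1`, `|c − g⁻¹|` -/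

omit [Valued K ℤᵐ⁰] [CompleteSpace K] [Fintype 𝓀[K]] in
/-- **`c(g) = ((1+g)κ′ − g)⁻¹`** for the κ-class representative `M(g)` (`x = y = (1+g)⁻¹`, polarisation `D(g) = P·(−(1+g)⁻¹, 1, g)`, `P = (π₀^{ρ+t})⁻¹`; tokens `e_B` at `ρ`,
`e_C` at `k₃`; `κ′ = e_Cπ₀^{k₃}∕(e_Bπ₀^{ρ})`): `c = D₁N(x)π₀^{ρ}e_B ∕ (D₀(π₀^{ρ}e_B − π₀^{k₃}e_C) + D₁N(x)π₀^{ρ}e_B)` (pure algebra). [folklore] -/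
theorem correction_latt_G3_rep_foot_eq {g eB eC : K} (hσg : σ g = g) (hg1 : (1 + g : K) ≠ 0) (heB0 : eB ≠ 0) (hϖ0 : ϖ ≠ 0) (hσϖ0 : σ ϖ ≠ 0)
    (ρ t k₃ : ℕ) :
    ((ϖ * σ ϖ) ^ (ρ + t))⁻¹ * (σ ((1 + g)⁻¹) * (1 + g)⁻¹) * ((ϖ * σ ϖ) ^ ρ * eB) /
        (-(((ϖ * σ ϖ) ^ (ρ + t))⁻¹ * (1 + g)⁻¹) * ((ϖ * σ ϖ) ^ ρ * eB - (ϖ * σ ϖ) ^ k₃ * eC) +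
          ((ϖ * σ ϖ) ^ (ρ + t))⁻¹ * (σ ((1 + g)⁻¹) * (1 + g)⁻¹) * ((ϖ * σ ϖ) ^ ρ * eB)) =
      ((1 + g) * (eC * (ϖ * σ ϖ) ^ k₃ / (eB * (ϖ * σ ϖ) ^ ρ)) - g)⁻¹ := by
  have hσ1g : σ ((1 + g)⁻¹) = (1 + g)⁻¹ := by rw [map_inv₀, map_add, map_one, hσg]
  have hP0 : (((ϖ * σ ϖ) ^ (ρ + t))⁻¹ : K) ≠ 0 := inv_ne_zero (pow_ne_zero _ (mul_ne_zero hϖ0 hσϖ0))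
  have hπρ : ((ϖ * σ ϖ) ^ ρ : K) ≠ 0 := pow_ne_zero _ (mul_ne_zero hϖ0 hσϖ0)
  set A : K := ((ϖ * σ ϖ) ^ (ρ + t))⁻¹ * (σ ((1 + g)⁻¹) * (1 + g)⁻¹) * ((ϖ * σ ϖ) ^ ρ * eB) with hA
  have hA0 : A ≠ 0 := by
    rw [hA, hσ1g]; exact mul_ne_zero (mul_ne_zero hP0 (mul_ne_zero (inv_ne_zero hg1) (inv_ne_zero hg1))) (mul_ne_zero hπρ heB0)
  have hB : -(((ϖ * σ ϖ) ^ (ρ + t))⁻¹ * (1 + g)⁻¹) * ((ϖ * σ ϖ) ^ ρ * eB - (ϖ * σ ϖ) ^ k₃ * eC) + A =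
      A * ((1 + g) * (eC * (ϖ * σ ϖ) ^ k₃ / (eB * (ϖ * σ ϖ) ^ ρ)) - g) := by
    rw [hA, hσ1g]; field_simp; ring
  rw [hB, div_mul_cancel_left₀ hA0]

omit [CompleteSpace K] [Fintype 𝓀[K]] in
/-- **THE LETTERS OF `c(g) = ((1+g)κ′ − g)⁻¹`** (`g ∈ F`, `|g| = |ϖ|^{2t}`, `ρ + t < k₃`, unit tokens): `σ c = c`, `|c|·|ϖ^{2t}| = 1` (`|(1+g)κ′| = |ϖ|^{2(k₃−ρ)} < |g|`), and,
for `d ≤ ρ`, the slot-2 test `|ϖ^{ρ+2t}|·|c − g⁻¹| ≤ |ϖ^{2d−1}| ↔ 2d ≤ ρ + 2t′ + 1` (`t′ = k₃ − ρ − t`): `c − g⁻¹ = (2g − (1+g)κ′)∕(((1+g)κ′ − g)·g)` with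
`|2g| = |ϖ|^{v(2)+2t}`, `|(1+g)κ′| = |ϖ|^{2t+2t′}`, and `ρ + v(2) ≥ 2d − 1` (★ `d_le_t_add_one`). [cite: Serre1979, Ch. V §3 Cor. 3; Ch. III §3 Prop. 7] -/
theorem v_correction_latt_G3_rep_foot {t₂ : ℕ} (hD : IsRamifiedQuadraticDatum σ ϖ d t₂)
    {ρ t : ℕ} (ht : 1 ≤ t) (k₃ : ℕ) (hlt : ρ + t < k₃)
    {g : K} (hσg : σ g = g) (hg : Valued.v g = Valued.v ϖ ^ (2 * t))
    {eC : K} (hσeC : σ eC = eC) (heC1 : Valued.v eC = 1) {eB : K} (hσeB : σ eB = eB) (heB1 : Valued.v eB = 1) :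
    σ (((1 + g) * (eC * (ϖ * σ ϖ) ^ k₃ / (eB * (ϖ * σ ϖ) ^ ρ)) - g)⁻¹) = ((1 + g) * (eC * (ϖ * σ ϖ) ^ k₃ / (eB * (ϖ * σ ϖ) ^ ρ)) - g)⁻¹ ∧
      Valued.v (((1 + g) * (eC * (ϖ * σ ϖ) ^ k₃ / (eB * (ϖ * σ ϖ) ^ ρ)) - g)⁻¹) * Valued.v (ϖ ^ (2 * t)) = 1 ∧
      (d ≤ ρ → (Valued.v (ϖ ^ (ρ + 2 * t)) * Valued.v (((1 + g) * (eC * (ϖ * σ ϖ) ^ k₃ / (eB * (ϖ * σ ϖ) ^ ρ)) - g)⁻¹ - g⁻¹) ≤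
          Valued.v (ϖ ^ (2 * d - 1)) ↔ 2 * d ≤ ρ + 2 * (k₃ - ρ - t) + 1)) := by
  obtain ⟨hσ, hvσ, hϖ, -, -, hd1, h2v⟩ := id hD
  have hdt₂ : d ≤ t₂ + 1 := d_le_t_add_one hD
  have hϖ0 : ϖ ≠ 0 := fun h0 => by rw [h0, map_zero] at hϖ; exact WithZero.coe_ne_zero hϖ.symm
  have hϖlt : Valued.v ϖ < 1 := by rw [hϖ, ← WithZero.exp_zero, WithZero.exp_lt_exp]; norm_num
  have hq : ∀ n : ℕ, Valued.v (ϖ ^ n) = WithZero.exp (-(n : ℤ)) := fun n => by rw [map_pow, v_varpi_pow hϖ]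
  have hvπ : ∀ k : ℕ, Valued.v ((ϖ * σ ϖ) ^ k) = WithZero.exp (-((2 * k : ℕ) : ℤ)) := fun k => by
    rw [map_pow, map_mul, hvσ, ← pow_two, ← pow_mul, v_varpi_pow hϖ]
  have hπσ : ∀ k : ℕ, σ ((ϖ * σ ϖ) ^ k) = (ϖ * σ ϖ) ^ k := fun k => by rw [map_pow, map_mul, hσ, mul_comm]
  have hg' : Valued.v g = WithZero.exp (-((2 * t : ℕ) : ℤ)) := by rw [hg, v_varpi_pow hϖ]
  have hg0 : g ≠ 0 := fun h => by rw [h, map_zero] at hg'; exact WithZero.coe_ne_zero hg'.symm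
  have hglt : Valued.v g < 1 := by rw [hg]; exact pow_lt_one₀ zero_le hϖlt (by omega)
  have hv1g : Valued.v (1 + g) = 1 := Valued.v.map_one_add_of_lt hglt
  set κ' : K := eC * (ϖ * σ ϖ) ^ k₃ / (eB * (ϖ * σ ϖ) ^ ρ) with hκ'def
  have hκ'v : Valued.v κ' = WithZero.exp (-((2 * (k₃ - ρ) : ℕ) : ℤ)) := by
    rw [hκ'def, map_div₀, map_mul, map_mul, heC1, heB1, one_mul, one_mul, hvπ, hvπ, ← WithZero.exp_sub]; congr 1; push_cast; omega
  have hσκ' : σ κ' = κ' := by rw [hκ'def, map_div₀, map_mul, map_mul, hσeC, hσeB, hπσ, hπσ]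
  have h1gκ : Valued.v ((1 + g) * κ') = WithZero.exp (-((2 * (k₃ - ρ) : ℕ) : ℤ)) := by rw [map_mul, hv1g, one_mul, hκ'v]
  have h2g : Valued.v (2 * g) = WithZero.exp (-((t₂ + 2 * t : ℕ) : ℤ)) := by
    rw [map_mul, h2v, v_varpi_pow hϖ, hg', ← WithZero.exp_add]; congr 1; push_cast; ring
  set D : K := (1 + g) * κ' - g with hDdef
  have hDlt : Valued.v ((1 + g) * κ') < Valued.v g := by rw [h1gκ, hg', WithZero.exp_lt_exp]; push_cast; omega
  have hDv : Valued.v D = WithZero.exp (-((2 * t : ℕ) : ℤ)) := by rw [hDdef, Valuation.map_sub_eq_of_lt_right _ hDlt, hg']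
  have hD0 : D ≠ 0 := fun h => by rw [h, map_zero] at hDv; exact WithZero.coe_ne_zero hDv.symm
  have hσD : σ D = D := by rw [hDdef, map_sub, map_mul, map_add, map_one, hσg, hσκ']
  refine ⟨by rw [map_inv₀, hσD], by rw [map_inv₀, hDv, hq, ← WithZero.exp_neg, ← WithZero.exp_add, neg_add_cancel, WithZero.exp_zero], fun hdρ => ?_⟩
  -- `c − g⁻¹ = (2g − (1+g)κ′)∕(D·g)`, `|ϖ^{ρ+2t}|·|c − g⁻¹| = |2g − (1+g)κ′|·exp(2t − ρ)`
  have hN : D⁻¹ - g⁻¹ = (2 * g - (1 + g) * κ') / (D * g) := by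
    rw [inv_sub_inv hD0 hg0]; congr 1; rw [hDdef]; ring
  have hL : Valued.v (ϖ ^ (ρ + 2 * t)) * Valued.v (D⁻¹ - g⁻¹) = Valued.v (2 * g - (1 + g) * κ') * WithZero.exp (((2 * t : ℕ) : ℤ) - ρ) := by
    rw [hN, map_div₀, map_mul, hDv, hg', hq, ← WithZero.exp_add, div_eq_mul_inv, ← WithZero.exp_neg, mul_left_comm, ← WithZero.exp_add]
    congr 2; push_cast; ring
  rw [hL, hq]
  constructor
  · -- (⇒): `ρ + 2t′ ≤ 2d − 2` forces `2t′ < v(2)`, the κ′-term leads, and the test fails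
    intro hle
    by_contra hcon
    have hlt' : Valued.v (2 * g) < Valued.v ((1 + g) * κ') := by rw [h2g, h1gκ, WithZero.exp_lt_exp]; push_cast; omega
    rw [Valuation.map_sub_eq_of_lt_right _ hlt', h1gκ, ← WithZero.exp_add, WithZero.exp_le_exp] at hle
    push_cast at hle
    omega
  · -- (⇐): both terms pass the test (`ρ + v(2) ≥ 2d − 1`, `ρ + 2t′ ≥ 2d − 1`)
    intro hge
    rcases le_total (Valued.v (2 * g)) (Valued.v ((1 + g) * κ')) with h | h
    · calc Valued.v (2 * g - (1 + g) * κ') * WithZero.exp (((2 * t : ℕ) : ℤ) - ρ)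
          ≤ Valued.v ((1 + g) * κ') * WithZero.exp (((2 * t : ℕ) : ℤ) - ρ) := mul_le_mul' ((Valuation.map_sub _ _ _).trans (max_le h le_rfl)) le_rfl
        _ ≤ WithZero.exp (-((2 * d - 1 : ℕ) : ℤ)) := by rw [h1gκ, ← WithZero.exp_add, WithZero.exp_le_exp]; push_cast; omega
    · calc Valued.v (2 * g - (1 + g) * κ') * WithZero.exp (((2 * t : ℕ) : ℤ) - ρ)
          ≤ Valued.v (2 * g) * WithZero.exp (((2 * t : ℕ) : ℤ) - ρ) := mul_le_mul' ((Valuation.map_sub _ _ _).trans (max_le le_rfl h)) le_rfl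
        _ ≤ WithZero.exp (-((2 * d - 1 : ℕ) : ℤ)) := by rw [h2g, ← WithZero.exp_add, WithZero.exp_le_exp]; push_cast; omega

/-! ## §3  The three indicators of the κ-class representative `M(g)` in closed form -/

/-- **THE INDICATORS OF THE TOWER-3 κ-CLASS REPRESENTATIVE, CLOSED FORM.**  For LH4-p18 (g0)'s representative
`M(g) = latt (1 0 0; (1+g)⁻¹ ϖ^{ρ+2t} 0; (1+g)⁻¹ −ϖ^{ρ+2t}g⁻¹ ϖ^{2ρ})` (`g ∈ F`, `|g| = |ϖ|^{2t}`), polarisation `P·(−(1+g)⁻¹, 1, g)`, tokens `e_B` (depth `ρ`), `e_C` (depth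
`k₃ > ρ + t`), `d ≤ ρ`, and the correction `c(g)` of ★ `…KappaClassRepFootG3` §3:
`𝟙₀(g) = 𝟙₁(g) = [2d − 1 ≤ ρ]`, `𝟙₂(g) = [2d ≤ ρ + 2t′ + 1]` (`t′ = k₃ − ρ − t`) — INDEPENDENT of `g` (★ `…KappaClassIndicatorsG3` §1–§2, §1–§2 here). [cite: Serre1979, Ch. V §3 Cor. 3; Ch. XV §2]
[cite: Kottwitz1986BaseChangeUnits, §1 pp. 240–241] [cite: LanglandsShelstad1987, §3] -/
theorem indicators_latt_G3_rep_foot {t₂ : ℕ} (hD : IsRamifiedQuadraticDatum σ ϖ d t₂) (h2 : Valued.v (2 : K) < 1)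
    {ρ t : ℕ} (hρ : 1 ≤ ρ) (ht : 1 ≤ t) (hdρ : d ≤ ρ) (k₃ : ℕ) (hlt : ρ + t < k₃)
    {g : K} (hσg : σ g = g) (hg : Valued.v g = Valued.v ϖ ^ (2 * t))
    {eC : K} (hσeC : σ eC = eC) (heC1 : Valued.v eC = 1) {eB : K} (hσeB : σ eB = eB) (heB1 : Valued.v eB = 1) :
    let M₀ : Submodule 𝒪[K] (Fin 3 → K) := latt (!![1, 0, 0; (1 + g)⁻¹, ϖ ^ (ρ + 2 * t), 0; (1 + g)⁻¹, -(ϖ ^ (ρ + 2 * t) * g⁻¹), ϖ ^ (2 * ρ)] : Matrix (Fin 3) (Fin 3) K)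
    let c : K := ((ϖ * σ ϖ) ^ (ρ + t))⁻¹ * (σ ((1 + g)⁻¹) * (1 + g)⁻¹) * ((ϖ * σ ϖ) ^ ρ * eB) /
      (-(((ϖ * σ ϖ) ^ (ρ + t))⁻¹ * (1 + g)⁻¹) * ((ϖ * σ ϖ) ^ ρ * eB - (ϖ * σ ϖ) ^ k₃ * eC) +
        ((ϖ * σ ϖ) ^ (ρ + t))⁻¹ * (σ ((1 + g)⁻¹) * (1 + g)⁻¹) * ((ϖ * σ ϖ) ^ ρ * eB))
    ((∀ u ∈ fixedUnitStabilizer σ M₀,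
        normSign σ ((u 0 : Kˣ) : K) * (normSign σ ((u 0 : Kˣ) : K) * normSign σ (1 + (((u 1 : Kˣ) : K) / ((u 0 : Kˣ) : K) - 1) * c)) = 1) ↔ 2 * d - 1 ≤ ρ) ∧
    ((∀ u ∈ fixedUnitStabilizer σ M₀,
        normSign σ ((u 1 : Kˣ) : K) * (normSign σ ((u 0 : Kˣ) : K) * normSign σ (1 + (((u 1 : Kˣ) : K) / ((u 0 : Kˣ) : K) - 1) * c)) = 1) ↔ 2 * d - 1 ≤ ρ) ∧
    ((∀ u ∈ fixedUnitStabilizer σ M₀,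
        normSign σ ((u 2 : Kˣ) : K) * (normSign σ ((u 0 : Kˣ) : K) * normSign σ (1 + (((u 1 : Kˣ) : K) / ((u 0 : Kˣ) : K) - 1) * c)) = 1) ↔
      2 * d ≤ ρ + 2 * (k₃ - ρ - t) + 1) := by
  intro M₀ c
  obtain ⟨hσ, hvσ, hϖ, -, -, hd1, -⟩ := id hD
  have hϖ0 : ϖ ≠ 0 := fun h0 => by rw [h0, map_zero] at hϖ; exact WithZero.coe_ne_zero hϖ.symm
  have hσϖ0 : σ ϖ ≠ 0 := (map_ne_zero σ).2 hϖ0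
  have hϖlt : Valued.v ϖ < 1 := by rw [hϖ, ← WithZero.exp_zero, WithZero.exp_lt_exp]; norm_num
  have hvϖ : 0 < Valued.v ϖ := (Valuation.pos_iff _).2 hϖ0
  have hglt : Valued.v g < 1 := by rw [hg]; exact pow_lt_one₀ zero_le hϖlt (by omega)
  have hg1 : (1 + g : K) ≠ 0 := fun h => by have := Valued.v.map_one_add_of_lt hglt; rw [h, map_zero] at this; exact zero_ne_one this
  have heB0 : eB ≠ 0 := fun h => by rw [h, map_zero] at heB1; exact zero_ne_one heB1
  have hceq : c = ((1 + g) * (eC * (ϖ * σ ϖ) ^ k₃ / (eB * (ϖ * σ ϖ) ^ ρ)) - g)⁻¹ := correction_latt_G3_rep_foot_eq hσg hg1 heB0 hϖ0 hσϖ0 ρ t k₃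
  obtain ⟨hσc, hcv, hT⟩ := v_correction_latt_G3_rep_foot hD ht k₃ hlt hσg hg hσeC heC1 hσeB heB1
  rw [← hceq] at hσc hcv hT
  -- the representative letters for §1–§3 (`s = 2t`, `x = y = (1+g)⁻¹`, `z = −ϖ^{ρ+2t}g⁻¹`)
  have hx : Valued.v ((1 + g)⁻¹ : K) = 1 := by rw [map_inv₀, Valued.v.map_one_add_of_lt hglt, inv_one]
  have hgs : Valued.v g = Valued.v (ϖ ^ (2 * t)) := by rw [hg, map_pow]
  have hz : Valued.v (-(ϖ ^ (ρ + 2 * t) * g⁻¹) : K) = Valued.v (ϖ ^ ρ) := by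
    rw [Valuation.map_neg, map_mul, map_inv₀, hg, map_pow, map_pow, pow_add, mul_assoc, mul_inv_cancel₀ (pow_ne_zero _ hvϖ.ne'), mul_one]
  have hxyz : ((1 + g)⁻¹ : K) * (-(ϖ ^ (ρ + 2 * t) * g⁻¹)) = -((1 + g)⁻¹ * ϖ ^ (ρ + 2 * t) * g⁻¹) := by ring
  exact ⟨indicator_zero_latt_G3_foot_iff hD h2 hρ (by omega : 1 ≤ 2 * t) hx hz hσg hgs hxyz rfl hσc hcv,
    indicator_one_latt_G3_foot_iff hD h2 hρ (by omega : 1 ≤ 2 * t) hx hz hσg hgs hxyz rfl hσc hcv,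
    (indicator_two_latt_G3_foot_iff hD h2 hρ (by omega : 1 ≤ 2 * t) (by omega) hx hx hz hσg hgs hxyz rfl hσc hcv).trans (hT hdρ)⟩

end Summit.HodgeConjecture.HodgeConjecture.Cruxes.H413.F0P3cDyRamLabelledOddKappaClassIndicatorTwoG3

end
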